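import Summits.KontsevichZagierPeriods.KontsevichZagierPeriods.Theorems.HurwitzMicroSectorsNormalFormPrincipleAlgCarriers
import Summits.KontsevichZagierPeriods.KontsevichZagierPeriods.Theorems.HurwitzMicroSectorsNormalFormPrincipleSlabASubPtK24

/-!
# `NormalFormPrinciple` (stmt-KontsevichZagierPeriods-3869), line `SketchIdeator1` —
# the leaf `stub_boxRigidity` in dimension one — the algebraic normal form `[pt, r] + Σ Λ(uⱼ, cⱼ)`

Pure proof file (lead seat c3; `--supports` the crux). The algebraic normal form of a class:
`[pt, r] + Σⱼ Λ(uⱼ, cⱼ)` with real algebraic `r`, `uⱼ > 1`, `cⱼ`. Additivity (`nfA_add`), points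
(`nfA_pt`), dlog intervals (`nfA_dlog`), higher real algebraic poles `[(0,1), c/(x−ρ)^{j+2}]`
(`nfA_pole_high`, one Newton–Leibniz move) and polynomial integrands (`nfA_poly`). The Newton–Leibniz
move `slabA_sub_pt_mem_relations` is imported from the sibling file `…SlabASubPtK24`; the simple pole
`nfA_pole_one` lives in `…SiegeNfAPoleOneK3`.

Sources: M. Kontsevich, D. Zagier, *Periods* (2001), §1.2 rules (1)–(3). No definitions are introduced.
-/

noncomputable section

open MeasureTheory Set Finset
open scoped Polynomial
open Literature.NumberTheory.Transcendental Literature.NumberTheory.Transcendental.KZ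
open Literature.ModelTheory.ExponentialFields (IsSemialgebraic isSemialgebraic_univ)

namespace Summit.KontsevichZagierPeriods.HurwitzMicroSectors.NormalFormPrinciple.PiBox

namespace Dlog

/-! ## The algebraic normal form: an algebraic point plus carriers `Λ(uⱼ, cⱼ)` -/

variable {RA : ℝ → ℝ → ℝ → IntegralRep 1} {ZA : ℝ → IntegralRep 0}

/-- **Additivity of algebraic normal forms** (concatenate the carrier families, add the points).
[cite: KontsevichZagier2001, §1.2 rule (1)] -/
theorem nfA_add
    (hZ : ∀ r, IsAlgebraic ℚ r → (ZA r).domain = univ ∧ (ZA r).integrand = fun _ => r)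
    {x y : FormalRep ⧸ relations}
    (hx : ∃ (r : ℝ) (k : ℕ) (u c : Fin k → ℝ), IsAlgebraic ℚ r ∧ (∀ j, 1 < u j) ∧
      (∀ j, IsAlgebraic ℚ (u j)) ∧ (∀ j, IsAlgebraic ℚ (c j)) ∧
      x = QuotientAddGroup.mk' relations (of (ZA r)) +
        ∑ j, QuotientAddGroup.mk' relations (of (RA 1 (u j) (c j))))
    (hy : ∃ (r : ℝ) (k : ℕ) (u c : Fin k → ℝ), IsAlgebraic ℚ r ∧ (∀ j, 1 < u j) ∧
      (∀ j, IsAlgebraic ℚ (u j)) ∧ (∀ j, IsAlgebraic ℚ (c j)) ∧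
      y = QuotientAddGroup.mk' relations (of (ZA r)) +
        ∑ j, QuotientAddGroup.mk' relations (of (RA 1 (u j) (c j)))) :
    ∃ (r : ℝ) (k : ℕ) (u c : Fin k → ℝ), IsAlgebraic ℚ r ∧ (∀ j, 1 < u j) ∧
      (∀ j, IsAlgebraic ℚ (u j)) ∧ (∀ j, IsAlgebraic ℚ (c j)) ∧
      x + y = QuotientAddGroup.mk' relations (of (ZA r)) +
        ∑ j, QuotientAddGroup.mk' relations (of (RA 1 (u j) (c j))) := by
  obtain ⟨r, k, u, c, hr, hu1, hu, hc, rfl⟩ := hx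
  obtain ⟨r', k', u', c', hr', hu1', hu', hc', rfl⟩ := hy
  refine ⟨r + r', k + k', Fin.append u u', Fin.append c c', hr.add hr', fun j => ?_, fun j => ?_,
    fun j => ?_, ?_⟩
  · refine Fin.addCases (fun i => ?_) (fun i => ?_) j
    · simpa using hu1 i
    · simpa using hu1' i
  · refine Fin.addCases (fun i => ?_) (fun i => ?_) j
    · simpa using hu i
    · simpa using hu' i
  · refine Fin.addCases (fun i => ?_) (fun i => ?_) j
    · simpa using hc i
    · simpa using hc' i
  have hpt : QuotientAddGroup.mk' relations (of (ZA (r + r'))) =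
      QuotientAddGroup.mk' relations (of (ZA r)) + QuotientAddGroup.mk' relations (of (ZA r')) := by
    have h := pt_add_mem_relations (r := r) (r' := r') (ZA (r + r')) (ZA r) (ZA r')
      (hZ _ (hr.add hr')).1 (hZ _ hr).1 (hZ _ hr').1 (hZ _ (hr.add hr')).2 (hZ _ hr).2 (hZ _ hr').2
    rw [← QuotientAddGroup.eq_zero_iff] at h
    change QuotientAddGroup.mk' relations _ = 0 at h
    rwa [map_sub, map_sub, sub_sub, sub_eq_zero] at h
  rw [hpt, Fin.sum_univ_add]
  simp only [Fin.append_left, Fin.append_right]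
  abel

/-- **A point representation with algebraic constant is in normal form.**
[cite: KontsevichZagier2001, §1.2 rule (1)] -/
theorem nfA_pt
    (hZ : ∀ r, IsAlgebraic ℚ r → (ZA r).domain = univ ∧ (ZA r).integrand = fun _ => r)
    {r : ℝ} (hr : IsAlgebraic ℚ r) (Zpt : IntegralRep 0) (hd : Zpt.domain = univ)
    (hi : Zpt.integrand = fun _ => r) :
    ∃ (r' : ℝ) (k : ℕ) (u c : Fin k → ℝ), IsAlgebraic ℚ r' ∧ (∀ j, 1 < u j) ∧
      (∀ j, IsAlgebraic ℚ (u j)) ∧ (∀ j, IsAlgebraic ℚ (c j)) ∧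
      QuotientAddGroup.mk' relations (of Zpt) = QuotientAddGroup.mk' relations (of (ZA r')) +
        ∑ j, QuotientAddGroup.mk' relations (of (RA 1 (u j) (c j))) := by
  refine ⟨r, 0, Fin.elim0, Fin.elim0, hr, fun j => j.elim0, fun j => j.elim0, fun j => j.elim0, ?_⟩
  rw [Finset.univ_eq_empty, Finset.sum_empty, add_zero]
  have h := pt_congr_mem_relations Zpt (ZA r) hd (hZ r hr).1 hi (hZ r hr).2
  rw [← QuotientAddGroup.eq_zero_iff] at h
  change QuotientAddGroup.mk' relations _ = 0 at h
  rwa [map_sub, sub_eq_zero] at h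

/-- **A dlog representation with algebraic data is in normal form**: `[(a,b), c/y] = Λ(b/a, c)`.
[cite: KontsevichZagier2001, §1.2 rule (2)] -/
theorem nfA_dlog
    (hR : ∀ a b c, IsAlgebraic ℚ a → IsAlgebraic ℚ b → IsAlgebraic ℚ c → 0 < a →
      (RA a b c).domain = {x | x 0 ∈ Set.Ioo a b} ∧ (RA a b c).integrand = fun x => c / x 0)
    (hZ : ∀ r, IsAlgebraic ℚ r → (ZA r).domain = univ ∧ (ZA r).integrand = fun _ => r)
    {a b c : ℝ} (ha : IsAlgebraic ℚ a) (hb : IsAlgebraic ℚ b) (hc : IsAlgebraic ℚ c)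
    (ha0 : 0 < a) (hab : a < b) (L : IntegralRep 1) (hd : L.domain = {x | x 0 ∈ Set.Ioo a b})
    (hi : EqOn L.integrand (fun x => c / x 0) L.domain) :
    ∃ (r : ℝ) (k : ℕ) (u c : Fin k → ℝ), IsAlgebraic ℚ r ∧ (∀ j, 1 < u j) ∧
      (∀ j, IsAlgebraic ℚ (u j)) ∧ (∀ j, IsAlgebraic ℚ (c j)) ∧
      QuotientAddGroup.mk' relations (of L) = QuotientAddGroup.mk' relations (of (ZA r)) +
        ∑ j, QuotientAddGroup.mk' relations (of (RA 1 (u j) (c j))) := by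
  refine ⟨0, 1, fun _ => b / a, fun _ => c, isAlgebraic_zero, fun _ => (one_lt_div ha0).mpr hab,
    fun _ => hb.mul ha.inv, fun _ => hc, ?_⟩
  have hZ0 : QuotientAddGroup.mk' relations (of (ZA 0)) = 0 :=
    (QuotientAddGroup.eq_zero_iff _).mpr (pt_zero_mem_relations (ZA 0) (hZ 0 isAlgebraic_zero).2)
  rw [hZ0, zero_add, Fin.sum_univ_one]
  exact carrierA_interval_eq hR ha hb hc ha0 L hd hi

/-- A power of `x₀ − ρ` times a constant, quotient form, is `ℚ`-semialgebraic on any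
`ℚ`-semialgebraic `s ⊆ ℝ¹` avoiding `ρ`, for algebraic `a, ρ`. [cite: BochnakCosteRoy1998, §2.2] -/
theorem isSemialgebraicFunOn_const_div_pow {s : Set (Fin 1 → ℝ)} (hs : IsSemialgebraic ℚ s)
    {a ρ : ℝ} (ha : IsAlgebraic ℚ a) (hρ : IsAlgebraic ℚ ρ) (n : ℕ) (h0 : ∀ x ∈ s, x 0 - ρ ≠ 0) :
    IsSemialgebraicFunOn ℚ s (fun x => a / (x 0 - ρ) ^ n) := by
  set aK : algebraicClosure ℚ ℝ := ⟨a, mem_algebraicClosure_iff.mpr ha⟩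
  set ρK : algebraicClosure ℚ ℝ := ⟨ρ, mem_algebraicClosure_iff.mpr hρ⟩
  have hQ : ∀ x : Fin 1 → ℝ, (Polynomial.aeval (x 0)
      ((Polynomial.X - Polynomial.C ρK) ^ n : (algebraicClosure ℚ ℝ)[X]) : ℝ) = (x 0 - ρ) ^ n := by
    intro x; simp [map_pow, map_sub]; rfl
  have hP : ∀ x : Fin 1 → ℝ, (Polynomial.aeval (x 0) (Polynomial.C aK : (algebraicClosure ℚ ℝ)[X]) : ℝ)
      = a := by
    intro x; simp; rfl
  refine (AlgSplitK5.isSemialgebraicFunOn_aevalK_div hs (Polynomial.C aK) ((Polynomial.X - Polynomial.C ρK) ^ n)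
    fun x hx => ?_).congr fun x _ => ?_
  · rw [hQ]; exact pow_ne_zero _ (h0 x hx)
  · show (Polynomial.aeval (x 0) (Polynomial.C aK : (algebraicClosure ℚ ℝ)[X]) : ℝ) /
      Polynomial.aeval (x 0) ((Polynomial.X - Polynomial.C ρK) ^ n : (algebraicClosure ℚ ℝ)[X]) = _
    rw [hP, hQ]

/-- **A higher algebraic pole on the unit slab is in normal form**: `[(0,1), c/(x − ρ)^{j+2}]` is ONE
Newton–Leibniz move from the algebraic point `[pt, F(1) − F(0)]`, `F = (−c/(j+1))/(x − ρ)^{j+1}`.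
[cite: KontsevichZagier2001, §1.2 rule (3)] -/
theorem nfA_pole_high
    {RA : ℝ → ℝ → ℝ → IntegralRep 1} {ZA : ℝ → IntegralRep 0}
    (hZ : ∀ r, IsAlgebraic ℚ r → (ZA r).domain = univ ∧ (ZA r).integrand = fun _ => r)
    {c ρ : ℝ} (hc : IsAlgebraic ℚ c) (hρA : IsAlgebraic ℚ ρ) (hρ : ρ ∉ Set.Icc (0:ℝ) 1) (j : ℕ)
    (T : IntegralRep 1) (hTd : T.domain = {x | x 0 ∈ Set.Ioo (0:ℝ) 1})
    (hTi : EqOn T.integrand (fun x => c / (x 0 - ρ) ^ (j + 2)) T.domain) :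
    ∃ (r : ℝ) (k : ℕ) (u c : Fin k → ℝ), IsAlgebraic ℚ r ∧ (∀ j, 1 < u j) ∧
      (∀ j, IsAlgebraic ℚ (u j)) ∧ (∀ j, IsAlgebraic ℚ (c j)) ∧
      QuotientAddGroup.mk' relations (of T) = QuotientAddGroup.mk' relations (of (ZA r)) +
        ∑ j, QuotientAddGroup.mk' relations (of (RA 1 (u j) (c j))) := by
  have hρt : ∀ t ∈ Set.Icc (0:ℝ) 1, t - ρ ≠ 0 := by
    intro t ht h; apply hρ; rw [sub_eq_zero] at h; rw [← h]; exact ht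
  set a : ℝ := -c / ((j:ℝ) + 1) with ha_def
  have hj : ((j:ℝ) + 1) ≠ 0 := by positivity
  have haA : IsAlgebraic ℚ a := by
    rw [ha_def, div_eq_mul_inv]
    exact hc.neg.mul ((isAlgebraic_nat (R := ℚ) j).add isAlgebraic_one).inv
  set F : ℝ → ℝ := fun u => a / (u - ρ) ^ (j + 1) with hF
  set r : ℝ := F 1 - F 0 with hr_def
  have hrA : IsAlgebraic ℚ r := by
    rw [hr_def, hF]
    simp only
    rw [div_eq_mul_inv, div_eq_mul_inv]
    exact (haA.mul ((isAlgebraic_one.sub hρA).pow _).inv).sub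
      (haA.mul ((isAlgebraic_zero.sub hρA).pow _).inv)
  have hIcc : IsSemialgebraic ℚ {x : Fin 1 → ℝ | x 0 ∈ Set.Icc (0:ℝ) 1} :=
    SlabA.isSemialgebraic_setOf_apply_mem_Icc isAlgebraic_zero isAlgebraic_one
  have hmove : of T - of (ZA r) ∈ relations := by
    refine SlabA.slabA_sub_pt_mem_relations isAlgebraic_zero isAlgebraic_one zero_le_one
      (fun t => c / (t - ρ) ^ (j + 2)) F ?_ ?_ (fun t ht => ?_) ?_ T hTd (fun x hx => by rw [hTi hx])
      (ZA r) (hZ r hrA).1 (hZ r hrA).2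
    · exact isSemialgebraicFunOn_const_div_pow hIcc haA hρA (j + 1) fun x hx => hρt (x 0) hx
    · exact continuousOn_const.div ((continuousOn_id.sub continuousOn_const).pow _)
        fun t ht => pow_ne_zero _ (hρt t ht)
    · have h := hasDerivAt_const_div_pow a ρ j (hρt t (Set.Ioo_subset_Icc_self ht))
      have hval : -(a * (j + 1)) / (t - ρ) ^ (j + 2) = c / (t - ρ) ^ (j + 2) := by
        rw [ha_def]; field_simp
      rw [hval] at h
      exact h
    · exact isSemialgebraicFunOn_const_div_pow hIcc hc hρA (j + 2) fun x hx => hρt (x 0) hx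
  obtain ⟨r', k, u, c', hr', hu1, hu, hc', hEq⟩ := nfA_pt (RA := RA) hZ hrA (ZA r) (hZ r hrA).1
    (hZ r hrA).2
  refine ⟨r', k, u, c', hr', hu1, hu, hc', ?_⟩
  rw [← hEq]
  rw [← QuotientAddGroup.eq_zero_iff] at hmove
  change QuotientAddGroup.mk' relations _ = 0 at hmove
  rwa [map_sub, sub_eq_zero] at hmove

/-- **A polynomial integrand with algebraic coefficients is in normal form**: `[(0,1), P(x)/q₀]`
(`P ∈ K[X]`, `q₀ ∈ K ∖ {0}`) is ONE Newton–Leibniz move from the algebraic point `[pt, G(1) − G(0)]`.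
[cite: KontsevichZagier2001, §1.2 rule (3)] -/
theorem nfA_poly
    {RA : ℝ → ℝ → ℝ → IntegralRep 1} {ZA : ℝ → IntegralRep 0}
    (hZ : ∀ r, IsAlgebraic ℚ r → (ZA r).domain = univ ∧ (ZA r).integrand = fun _ => r)
    (P : (algebraicClosure ℚ ℝ)[X]) {q₀ : algebraicClosure ℚ ℝ} (hq₀ : q₀ ≠ 0) (T : IntegralRep 1)
    (hTd : T.domain = {x | x 0 ∈ Set.Ioo (0:ℝ) 1})
    (hTi : EqOn T.integrand (fun x => (Polynomial.aeval (x 0) P : ℝ) / (q₀ : ℝ)) T.domain) :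
    ∃ (r : ℝ) (k : ℕ) (u c : Fin k → ℝ), IsAlgebraic ℚ r ∧ (∀ j, 1 < u j) ∧
      (∀ j, IsAlgebraic ℚ (u j)) ∧ (∀ j, IsAlgebraic ℚ (c j)) ∧
      QuotientAddGroup.mk' relations (of T) = QuotientAddGroup.mk' relations (of (ZA r)) +
        ∑ j, QuotientAddGroup.mk' relations (of (RA 1 (u j) (c j))) := by
  obtain ⟨G, hG⟩ := AlgSplitK5.exists_polynomial_hasDerivAtK (Polynomial.C q₀⁻¹ * P)
  set r : ℝ := (Polynomial.aeval (1:ℝ) G : ℝ) - Polynomial.aeval (0:ℝ) G with hr_def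
  have hrA : IsAlgebraic ℚ r :=
    (isAlgebraic_aevalK G isAlgebraic_one).sub (isAlgebraic_aevalK G isAlgebraic_zero)
  have hIcc : IsSemialgebraic ℚ {x : Fin 1 → ℝ | x 0 ∈ Set.Icc (0:ℝ) 1} :=
    SlabA.isSemialgebraic_setOf_apply_mem_Icc isAlgebraic_zero isAlgebraic_one
  have hq₀' : ((q₀ : ℝ)) ≠ 0 := by
    intro h; apply hq₀; exact_mod_cast h
  have hmove : of T - of (ZA r) ∈ relations := by
    refine SlabA.slabA_sub_pt_mem_relations isAlgebraic_zero isAlgebraic_one zero_le_one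
      (fun t => (Polynomial.aeval t P : ℝ) / (q₀ : ℝ)) (fun u => (Polynomial.aeval u G : ℝ))
      (AlgSplitK5.isSemialgebraicFunOn_aevalK hIcc G) (Polynomial.continuous_aeval G).continuousOn
      (fun t _ => ?_) ?_ T hTd (fun x hx => by rw [hTi hx]) (ZA r) (hZ r hrA).1 (hZ r hrA).2
    · have h := hG t
      have e0 : (algebraMap (algebraicClosure ℚ ℝ) ℝ q₀ : ℝ) = (q₀ : ℝ) := rfl
      have hval : (Polynomial.aeval t (Polynomial.C q₀⁻¹ * P) : ℝ) =
          (Polynomial.aeval t P : ℝ) / (q₀ : ℝ) := by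
        rw [map_mul, Polynomial.aeval_C, map_inv₀, e0]
        ring
      rw [hval] at h
      exact h
    · have e0 : (algebraMap (algebraicClosure ℚ ℝ) ℝ q₀ : ℝ) = (q₀ : ℝ) := rfl
      refine (AlgSplitK5.isSemialgebraicFunOn_aevalK_div hIcc P (Polynomial.C q₀) fun x _ => ?_).congr
        fun x _ => ?_
      · rw [Polynomial.aeval_C, e0]; exact hq₀'
      · show (Polynomial.aeval (x 0) P : ℝ) / Polynomial.aeval (x 0) (Polynomial.C q₀) = _
        rw [Polynomial.aeval_C, e0]
  obtain ⟨r', k, u, c', hr', hu1, hu, hc', hEq⟩ := nfA_pt (RA := RA) hZ hrA (ZA r) (hZ r hrA).1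
    (hZ r hrA).2
  refine ⟨r', k, u, c', hr', hu1, hu, hc', ?_⟩
  rw [← hEq]
  rw [← QuotientAddGroup.eq_zero_iff] at hmove
  change QuotientAddGroup.mk' relations _ = 0 at hmove
  rwa [map_sub, sub_eq_zero] at hmove

end Dlog

end Summit.KontsevichZagierPeriods.HurwitzMicroSectors.NormalFormPrinciple.PiBox
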